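import Summits.SmoothPoincare4.SmoothPoincare4.Theses.EntropyRung

/-!
# Line `decay-climb-numax` for crux `EntropyRung.CompactShrinkerGap` (stmt-SmoothPoincare4-10870)

Skeleton (crux-plan, planner-cruxplan-stmt-SmoothPoincare4-10870-decay-climb-numax-0, 2026-08-15),
merging idea cards `decay-climb-numax` ≈ `density-summit-stability` with the three triage sharpenings
(K_rig concludes EINSTEIN `Hess f ≡ 0`, not `M ≅ S⁴`; competitors quantified over the full crux clause
set on the same charted space `M`; the line is explicitly CONDITIONAL on the sibling crux
`NoncompactShrinkerGap`, stmt-SmoothPoincare4-10868, which enters BY NAME as the hypothesis of the two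
stubs that use it and of the composition).

Notation in comments: `Z(g,f) := ∫⁻ e^{-f} dV_g` (so `Θ = Z/16π²`), `Z₀ := 32π²√π e^{-3/2}`
(`= 16π²·Θ(S³×ℝ)`), `ν_cyl := log 2 + ½ log π − 3/2 = log Θ(S³×ℝ)`, and for a metric `g₀` and a real
`c`, `NuFloor(g₀,c)` is the clause "∀ τ > 0 ∀ φ smooth with ∫(4πτ)⁻²e^{-φ}dV₀ = 1,
c ≤ ∫[τ(R₀ + |∇φ|²) + φ − 4](4πτ)⁻²e^{-φ}dV₀", i.e. `μ(g₀,τ) ≥ c` for all `τ`, i.e. `ν(g₀) ≥ c` —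
literally the entropy clause of `SubcylindricalRecognition` with `ν_cyl + δ` replaced by `c`.

THE LINE (climb the decay lowerarchy on the fixed homotopy sphere):
* `stub_densestShrinker` (K_cpt, no-escape compactness): on a closed `M ≃ₕ S⁴` carrying one normalised
  smooth shrinker of mass `Z > Z₀`, the mass is MAXIMISED by some normalised smooth shrinker `(g⋆,f⋆)`
  on the same `M` (Haslhofer–Müller / Bamler compactness under the entropy floor `log Θ > ν_cyl`;
  orbifold limits have `Θ ≤ ½`, non-compact limits are excluded by `NoncompactShrinkerGap`, compact
  limits are diffeomorphic to `M` and pull back).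
* `stub_entropyDominance` (K_dom = the RUNG engine minus this crux): every `R > 0` metric `g₀` on `M`
  with `ν(g₀) ≥ c > ν_cyl` is dominated by a normalised smooth shrinker ON `M` of mass `≥ 16π²e^c`
  (Perelman monotonicity + Bamler's singular-time tangent flows: the model has `Θ ≥ e^{ν(g₀)}`, is not
  an orbifold (`Θ > ½`), not non-compact (`NoncompactShrinkerGap`), hence compact smooth and `≅ M`).
  `rung_of_dominance` below CERTIFIES that this stub and the crux together give
  `SubcylindricalRecognition` (so the stub is exactly the part of stmt-10869 not already in 10870).
* `stub_maximiserIsEinstein` (K_rig, the transfer target C⁺, HARDEST): a normalised smooth shrinker on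
  `M ≃ₕ S⁴` with `Z > Z₀` whose mass dominates `16π²e^c` for every `R > 0` competitor `g₀` on `M` with
  `NuFloor(g₀,c)`, `c > ν_cyl` — i.e. a GLOBAL maximiser of Perelman's `ν` over positive-scalar-curvature
  metrics on `M`, hence a local `ν`-maximum, hence `ν`-stable (Kröncke 2015 Thm 1.2–1.3, Cao–Zhu 2024
  Thm 1.2) — is EINSTEIN: `Hess f ≡ 0`. This is Cao's Conjecture 2 (Cao–Zhu 2024, Conj. 2) restricted to
  {`b₂ = 0`, `Θ > Θ_cyl`, globally `ν`-maximal}; analytic conclusion, contentful on the standard `S⁴`.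
* `stub_einsteinEndgame` (Einstein sub-case of the crux, KNOWN: Gursky 2000 + Besse 1.118 + Hamilton
  PIC / Kuiper; in tree modulo the named facts `gursky_einstein_homotopySphere_four`,
  `hamilton_pic_sphere_four`): `Hess f ≡ 0` forces `f ≡ 2`, `Ric = g/2`, `Vol = e²Z > e²Z₀ ≈ 923 > 32π²`,
  so Gursky's alternative `Vol ≤ 32π²` is impossible, `W ≡ 0`, constant curvature, `M ≅ S⁴`.
* `CompactShrinkerGap_of : NoncompactShrinkerGap → CompactShrinkerGap` — the kernel-checked
  composition (take `g⋆` from K_cpt; K_dom + maximality make it `ν`-dominant; K_rig makes it Einstein;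
  the endgame recognises `S⁴`).

Disproof.lean (cdisprove v3) honoured: every stub keeps `[CompactSpace M]` and `M ≃ₕ S⁴`
(`withoutCompactHomotopy_false`: closedness is load-bearing — used in K_cpt/K_dom for Kröncke/HM/Bamler
on closed `M`, in the endgame for `χ = 2`, `τ = 0` and the maximum principle `f ≤ 2`); K_rig is NOT
SPC4-implied (§0/§5 criterion: its conclusion is `Hess f = 0`, falsifiable by a dense non-Einstein
`ν`-maximal shrinker on the standard `S⁴`); the endgame uses the Jensen/volume route of §6–§7
(`volume_floor_of_density`, `gursky_bound_lt_threshold`). Negatives index: empty (2026-08-15).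
-/

namespace Summit.SmoothPoincare4.SmoothPoincare4.Cruxes.CompactShrinkerGap.DecayClimbNumax

open scoped Manifold ContDiff ENNReal Topology ContinuousMap
open MeasureTheory
open Summit.SmoothPoincare4.SmoothPoincare4.Theses.EntropyRung
open Literature.Geometry.Lorentzian

set_option linter.unusedVariables false
set_option linter.dupNamespace false

/-- **K_cpt — the densest shrinker on `Σ` exists (no-escape compactness).** Given the sibling crux
`NoncompactShrinkerGap`, on a closed smooth `M ≃ₕ S⁴` carrying a normalised smooth gradient shrinker
`(g,f)` (`Ric + Hess f = g/2`, `R + |∇f|² = f`) of mass `Z(g,f) > Z₀ = 32π²√π e^{-3/2}`, there is a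
normalised smooth gradient shrinker `(g⋆,f⋆)` on the SAME `M` with `Z(g,f) ≤ Z(g⋆,f⋆)` and
`Z(g',f') ≤ Z(g⋆,f⋆)` for every normalised smooth Riemannian gradient shrinker `(g',f')` on `M`.
Why plausibly true: `Z ≤ 16π²(1−δ₀)` (Yokota / Li–Wang gap), a maximising sequence has entropy
`μ ≥ log Θ_cyl`, so it subconverges (Haslhofer–Müller 2011/2015, or Bamler 2020–23 F-compactness) to
an orbifold shrinker with the limit mass (uniform Gaussian tightness of `e^{-f}dV`, Cao–Zhou /
HM Lemma 2.1–2.3); an orbifold point forces `Θ ≤ ½ < Θ_cyl`, a non-compact limit has `Θ ≤ Θ_cyl`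
by `NoncompactShrinkerGap` (strictly below the limit mass) — so the limit is compact, smooth,
diffeomorphic to `M`, and pulls back to `M` (`HasLeviCivita` from
`isCovariantDerivativeOn_leviCivitaFun_holds`). Size L (needs the HM/Bamler compactness package). -/
theorem stub_densestShrinker :
    NoncompactShrinkerGap →
    ∀ (M : Type) [TopologicalSpace M] [T2Space M] [SecondCountableTopology M]
      [ChartedSpace (EuclideanSpace ℝ (Fin 4)) M] [IsManifold (𝓡 4) ∞ M] [CompactSpace M] [T3Space M]
      [MeasurableSpace M] [BorelSpace M],
      M ≃ₕ Metric.sphere (0 : EuclideanSpace ℝ (Fin 5)) 1 →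
      ∀ (g : PseudoRiemannianMetric (𝓡 4) ∞ (EuclideanSpace ℝ (Fin 4)) (TangentSpace (𝓡 4) : M → Type _))
        [g.HasLeviCivita] (f : M → ℝ) (hg : g.IsRiemannian),
        ContMDiff (𝓡 4) 𝓘(ℝ, ℝ) ∞ f →
        (∀ (x : M) (X Y : TangentSpace (𝓡 4) x),
          g.ricci x X Y + g.hessian f x X Y = (1 / 2 : ℝ) * g.val x X Y) →
        (∀ x : M, g.scalarCurvature x + g.gradSq f x = f x) →
        ENNReal.ofReal (32 * Real.pi ^ 2 * Real.sqrt Real.pi * Real.exp (-(3 : ℝ) / 2)) <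
          ∫⁻ x, ENNReal.ofReal (Real.exp (-f x)) ∂(riemannianMeasure (g.toContMDiffRiemannianMetric hg)) →
        ∃ gs : PseudoRiemannianMetric (𝓡 4) ∞ (EuclideanSpace ℝ (Fin 4)) (TangentSpace (𝓡 4) : M → Type _),
        ∃ _ : gs.HasLeviCivita, ∃ (fs : M → ℝ) (hgs : gs.IsRiemannian),
          ContMDiff (𝓡 4) 𝓘(ℝ, ℝ) ∞ fs ∧
          (∀ (x : M) (X Y : TangentSpace (𝓡 4) x),
            gs.ricci x X Y + gs.hessian fs x X Y = (1 / 2 : ℝ) * gs.val x X Y) ∧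
          (∀ x : M, gs.scalarCurvature x + gs.gradSq fs x = fs x) ∧
          ∫⁻ x, ENNReal.ofReal (Real.exp (-f x)) ∂(riemannianMeasure (g.toContMDiffRiemannianMetric hg)) ≤
            ∫⁻ x, ENNReal.ofReal (Real.exp (-fs x)) ∂(riemannianMeasure (gs.toContMDiffRiemannianMetric hgs)) ∧
          ∀ (g' : PseudoRiemannianMetric (𝓡 4) ∞ (EuclideanSpace ℝ (Fin 4)) (TangentSpace (𝓡 4) : M → Type _))
            [g'.HasLeviCivita] (f' : M → ℝ) (hg' : g'.IsRiemannian),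
            ContMDiff (𝓡 4) 𝓘(ℝ, ℝ) ∞ f' →
            (∀ (x : M) (X Y : TangentSpace (𝓡 4) x),
              g'.ricci x X Y + g'.hessian f' x X Y = (1 / 2 : ℝ) * g'.val x X Y) →
            (∀ x : M, g'.scalarCurvature x + g'.gradSq f' x = f' x) →
            ∫⁻ x, ENNReal.ofReal (Real.exp (-f' x)) ∂(riemannianMeasure (g'.toContMDiffRiemannianMetric hg')) ≤
              ∫⁻ x, ENNReal.ofReal (Real.exp (-fs x)) ∂(riemannianMeasure (gs.toContMDiffRiemannianMetric hgs)) := by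
  sorry

/-- **K_dom — entropy dominance on `Σ` (the RUNG engine minus `CompactShrinkerGap`).** Given
`NoncompactShrinkerGap`: on a closed smooth `M ≃ₕ S⁴`, every Riemannian metric `g₀` with `R > 0` and
`ν(g₀) ≥ c` for some `c > ν_cyl` (clause `NuFloor(g₀,c)`: `μ(g₀,τ) ≥ c` for every `τ > 0`, unfolded
exactly as in `SubcylindricalRecognition`) is DOMINATED by a normalised smooth gradient shrinker
`(g,f)` on the same `M` of mass `Z(g,f) ≥ 16π²e^c` (i.e. density `Θ ≥ e^c ≥ e^{ν(g₀)}`).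
Why plausibly true: `R > 0` ⇒ singular time `T ≤ 2/R_min`; Perelman's monotonicity gives every
tangent flow at `T` Nash entropy `≥ ν(g₀) ≥ c`; by Bamler 2020–23 the tangent flow at a singular point
is a non-flat gradient shrinker smooth off isolated orbifold points with `log Θ ≥ c > ν_cyl`; an
orbifold point forces `Θ ≤ ½`, non-compactness forces `Θ ≤ Θ_cyl` (`NoncompactShrinkerGap`), so the
model is compact smooth, the rescaled flow converges globally and `M ≅` the model, whose normalised
structure pulls back to `M`. This is word for word the intended proof of stmt-10869 minus its last
line; see `rung_of_dominance`. Size XL (Perelman `μ`-monotonicity + Bamler's package, none in tree). -/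
theorem stub_entropyDominance :
    NoncompactShrinkerGap →
    ∀ (M : Type) [TopologicalSpace M] [T2Space M] [SecondCountableTopology M]
      [ChartedSpace (EuclideanSpace ℝ (Fin 4)) M] [IsManifold (𝓡 4) ∞ M] [CompactSpace M] [T3Space M]
      [MeasurableSpace M] [BorelSpace M],
      M ≃ₕ Metric.sphere (0 : EuclideanSpace ℝ (Fin 5)) 1 →
      ∀ (g₀ : PseudoRiemannianMetric (𝓡 4) ∞ (EuclideanSpace ℝ (Fin 4)) (TangentSpace (𝓡 4) : M → Type _))
        [g₀.HasLeviCivita] (hg₀ : g₀.IsRiemannian),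
        (∀ x : M, 0 < g₀.scalarCurvature x) →
        ∀ c : ℝ, Real.log 2 + Real.log Real.pi / 2 - 3 / 2 < c →
        (∀ τ : ℝ, 0 < τ → ∀ φ : M → ℝ, ContMDiff (𝓡 4) 𝓘(ℝ, ℝ) ∞ φ →
          ∫ x, (4 * Real.pi * τ) ^ (-(4 : ℝ) / 2) * Real.exp (-φ x)
            ∂(riemannianMeasure (g₀.toContMDiffRiemannianMetric hg₀)) = 1 →
          c ≤ ∫ x, (τ * (g₀.scalarCurvature x + g₀.gradSq φ x) + φ x - 4) *
            ((4 * Real.pi * τ) ^ (-(4 : ℝ) / 2) * Real.exp (-φ x))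
            ∂(riemannianMeasure (g₀.toContMDiffRiemannianMetric hg₀))) →
        ∃ g : PseudoRiemannianMetric (𝓡 4) ∞ (EuclideanSpace ℝ (Fin 4)) (TangentSpace (𝓡 4) : M → Type _),
        ∃ _ : g.HasLeviCivita, ∃ (f : M → ℝ) (hg : g.IsRiemannian),
          ContMDiff (𝓡 4) 𝓘(ℝ, ℝ) ∞ f ∧
          (∀ (x : M) (X Y : TangentSpace (𝓡 4) x),
            g.ricci x X Y + g.hessian f x X Y = (1 / 2 : ℝ) * g.val x X Y) ∧
          (∀ x : M, g.scalarCurvature x + g.gradSq f x = f x) ∧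
          ENNReal.ofReal (16 * Real.pi ^ 2 * Real.exp c) ≤
            ∫⁻ x, ENNReal.ofReal (Real.exp (-f x)) ∂(riemannianMeasure (g.toContMDiffRiemannianMetric hg)) := by
  sorry

/-- **K_rig — a globally `ν`-maximal dense shrinker on a homotopy 4-sphere is Einstein** (the
transfer target C⁺; HARDEST stub). On a closed smooth `M ≃ₕ S⁴`, let `(g,f)` be a normalised smooth
gradient shrinker with `Z(g,f) > Z₀` such that `16π²e^c ≤ Z(g,f)` whenever `g₀` is a Riemannian metric
on `M` with `R > 0` and `NuFloor(g₀,c)` for some `c > ν_cyl` (so, by Carrillo–Ni `ν(g) = log Θ(g)` and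
`R_g > 0`, `g` is a GLOBAL maximiser of Perelman's `ν` over the open set {`R > 0`, `ν > ν_cyl`} of
metrics on `M`, a fortiori a local maximiser, hence dynamically and linearly `ν`-stable: Kröncke 2015
Thm 1.2–1.3, second variation `≤ 0` in the Cao–Hamilton–Ilmanen / Cao–Zhu 2024 Thm 1.2 form
`ℒ_f ≤ 0` on `Ker(div_f)₀`). Then `Hess f ≡ 0` (Einstein, `Ric = g/2`).
Why it might fail / why plausibly true: it is Cao's Conjecture 2 ("a `ν`-stable compact shrinking
soliton is Einstein, at least in dimension four", Cao 2006; Cao–Zhu 2024 Conj. 2, open) in the class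
{`b₂(M) = 0`, `Θ > .791`, GLOBAL `ν`-maximality} — strictly more hypothesis than linear stability; no
non-Einstein compact shrinker with `b₂ = 0` is known at all, every known non-round compact 4-d
shrinker is proved unstable (Hall–Murphy, Hall–Haslhofer–Siepmann, Biquard–Ozuch, Knopf–Šešum) and
has `Θ ≤ .609`. NOT SPC4-implied: falsifiable on the standard `S⁴` by a dense non-Einstein
`ν`-dominant shrinker. First cash-able tests (card density-summit-stability, triage-checked):
`4∫|E̊|²e^{-f} = ∫S(2−S)e^{-f}`, `⟨ℒ_f E̊,E̊⟩_f = ¼∫(2−S)|E̊|²e^{-f}`. Size: open-problem class. -/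
theorem stub_maximiserIsEinstein :
    ∀ (M : Type) [TopologicalSpace M] [T2Space M] [SecondCountableTopology M]
      [ChartedSpace (EuclideanSpace ℝ (Fin 4)) M] [IsManifold (𝓡 4) ∞ M] [CompactSpace M] [T3Space M]
      [MeasurableSpace M] [BorelSpace M],
      M ≃ₕ Metric.sphere (0 : EuclideanSpace ℝ (Fin 5)) 1 →
      ∀ (g : PseudoRiemannianMetric (𝓡 4) ∞ (EuclideanSpace ℝ (Fin 4)) (TangentSpace (𝓡 4) : M → Type _))
        [g.HasLeviCivita] (f : M → ℝ) (hg : g.IsRiemannian),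
        ContMDiff (𝓡 4) 𝓘(ℝ, ℝ) ∞ f →
        (∀ (x : M) (X Y : TangentSpace (𝓡 4) x),
          g.ricci x X Y + g.hessian f x X Y = (1 / 2 : ℝ) * g.val x X Y) →
        (∀ x : M, g.scalarCurvature x + g.gradSq f x = f x) →
        ENNReal.ofReal (32 * Real.pi ^ 2 * Real.sqrt Real.pi * Real.exp (-(3 : ℝ) / 2)) <
          ∫⁻ x, ENNReal.ofReal (Real.exp (-f x)) ∂(riemannianMeasure (g.toContMDiffRiemannianMetric hg)) →
        (∀ (g₀ : PseudoRiemannianMetric (𝓡 4) ∞ (EuclideanSpace ℝ (Fin 4)) (TangentSpace (𝓡 4) : M → Type _))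
          [g₀.HasLeviCivita] (hg₀ : g₀.IsRiemannian),
          (∀ x : M, 0 < g₀.scalarCurvature x) →
          ∀ c : ℝ, Real.log 2 + Real.log Real.pi / 2 - 3 / 2 < c →
          (∀ τ : ℝ, 0 < τ → ∀ φ : M → ℝ, ContMDiff (𝓡 4) 𝓘(ℝ, ℝ) ∞ φ →
            ∫ x, (4 * Real.pi * τ) ^ (-(4 : ℝ) / 2) * Real.exp (-φ x)
              ∂(riemannianMeasure (g₀.toContMDiffRiemannianMetric hg₀)) = 1 →
            c ≤ ∫ x, (τ * (g₀.scalarCurvature x + g₀.gradSq φ x) + φ x - 4) *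
              ((4 * Real.pi * τ) ^ (-(4 : ℝ) / 2) * Real.exp (-φ x))
              ∂(riemannianMeasure (g₀.toContMDiffRiemannianMetric hg₀))) →
          ENNReal.ofReal (16 * Real.pi ^ 2 * Real.exp c) ≤
            ∫⁻ x, ENNReal.ofReal (Real.exp (-f x)) ∂(riemannianMeasure (g.toContMDiffRiemannianMetric hg))) →
        ∀ (x : M) (X Y : TangentSpace (𝓡 4) x), g.hessian f x X Y = 0 := by
  sorry

/-- **Einstein endgame (the closed sub-case of the crux; KNOWN).** On a closed smooth `M ≃ₕ S⁴`, a
normalised smooth gradient shrinker `(g,f)` with `Z(g,f) > Z₀` and `Hess f ≡ 0` lives on `M ≅ S⁴`.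
Proof sketch (Gursky 2000 Thm 1 + Besse 1.118 + Hamilton PIC / Kuiper; Disproof §6–§7): `Hess f = 0`
gives `Ric = g/2`, so `R = 2`; at a maximum point of `f` (compactness) `|∇f|² = 0`, so `f_max = 2` by
the normalisation and `|∇f|² = f − 2 ≤ 0` everywhere, whence `f ≡ 2` and `Z = e^{-2}·Vol(M,g)`; the
mass bound gives `Vol > e²Z₀ = 32π²√π e^{1/2} ≈ 923 > 32π²` (`volume_floor_of_density`,
`thirtyTwo_pi_sq_exp_neg_two_lt`), so in `gursky_einstein_homotopySphere_four`
(`weylFrame_eq_zero_or_volume_le_of_half`) the alternative `Vol ≤ 32π²` is impossible, `W ≡ 0`,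
constant curvature `1/6`, and `diffeomorph_sphere_or_volume_le` (Hamilton PIC fact; or Kuiper's
developing map, `kuiper_conformallyFlat_sphere_four_holds`) gives `M ≅ S⁴`. In tree modulo the named
facts `gursky_einstein_homotopySphere_four` and `hamilton_pic_sphere_four` (unproved Literature facts)
and the first-derivative test for `gradSq` at a maximum. Size M. -/
theorem stub_einsteinEndgame :
    ∀ (M : Type) [TopologicalSpace M] [T2Space M] [SecondCountableTopology M]
      [ChartedSpace (EuclideanSpace ℝ (Fin 4)) M] [IsManifold (𝓡 4) ∞ M] [CompactSpace M] [T3Space M]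
      [MeasurableSpace M] [BorelSpace M],
      M ≃ₕ Metric.sphere (0 : EuclideanSpace ℝ (Fin 5)) 1 →
      ∀ (g : PseudoRiemannianMetric (𝓡 4) ∞ (EuclideanSpace ℝ (Fin 4)) (TangentSpace (𝓡 4) : M → Type _))
        [g.HasLeviCivita] (f : M → ℝ) (hg : g.IsRiemannian),
        ContMDiff (𝓡 4) 𝓘(ℝ, ℝ) ∞ f →
        (∀ (x : M) (X Y : TangentSpace (𝓡 4) x),
          g.ricci x X Y + g.hessian f x X Y = (1 / 2 : ℝ) * g.val x X Y) →
        (∀ x : M, g.scalarCurvature x + g.gradSq f x = f x) →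
        ENNReal.ofReal (32 * Real.pi ^ 2 * Real.sqrt Real.pi * Real.exp (-(3 : ℝ) / 2)) <
          ∫⁻ x, ENNReal.ofReal (Real.exp (-f x)) ∂(riemannianMeasure (g.toContMDiffRiemannianMetric hg)) →
        (∀ (x : M) (X Y : TangentSpace (𝓡 4) x), g.hessian f x X Y = 0) →
        Nonempty (M ≃ₘ⟮𝓡 4, 𝓡 4⟯ (Metric.sphere (0 : EuclideanSpace ℝ (Fin 5)) 1)) := by
  sorry

/-- **The composition (kernel-checked, no `sorry` of its own): `NoncompactShrinkerGap → CompactShrinkerGap`.**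
Given a dense normalised shrinker `(g,f)` on `M ≃ₕ S⁴`: take the densest shrinker `(g⋆,f⋆)` on `M`
(`stub_densestShrinker`); for every `R > 0` competitor `g₀` with `NuFloor(g₀,c)`, `c > ν_cyl`,
`stub_entropyDominance` produces a shrinker on `M` of mass `≥ 16π²e^c`, which maximality bounds by
`Z(g⋆,f⋆)` — so `(g⋆,f⋆)` is `ν`-dominant; `stub_maximiserIsEinstein` makes it Einstein and
`stub_einsteinEndgame` recognises `M ≅ S⁴`. The sibling crux enters by name (route item
stmt-SmoothPoincare4-10868), exactly as in the rung. -/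
theorem CompactShrinkerGap_of (hgap : NoncompactShrinkerGap) : CompactShrinkerGap := by
  intro M _ _ _ _ _ _ _ _ _ e g _ f hg hf hsol hnorm hZ
  obtain ⟨gs, hLCs, fs, hgs, hfs, hsols, hnorms, hle, hmax⟩ :=
    stub_densestShrinker hgap M e g f hg hf hsol hnorm hZ
  haveI : gs.HasLeviCivita := hLCs
  have hZs := lt_of_lt_of_le hZ hle
  refine stub_einsteinEndgame M e gs fs hgs hfs hsols hnorms hZs
    (stub_maximiserIsEinstein M e gs fs hgs hfs hsols hnorms hZs ?_)
  intro g₀ _ hg₀ hR c hc hfloor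
  obtain ⟨g₁, hLC₁, f₁, hg₁, hf₁, hsol₁, hnorm₁, hZ₁⟩ :=
    stub_entropyDominance hgap M e g₀ hg₀ hR c hc hfloor
  haveI : g₁.HasLeviCivita := hLC₁
  exact hZ₁.trans (hmax g₁ f₁ hg₁ hf₁ hsol₁ hnorm₁)

/-- **Certificate that K_dom is "the rung minus this crux"** (sorry-free given the two statements as
hypotheses): the statement of `stub_entropyDominance` (with the sibling gap discharged) together with
`CompactShrinkerGap` yields `SubcylindricalRecognition` — take `c := ν_cyl + δ`. So proving
`stub_entropyDominance` is work the route owes anyway for stmt-SmoothPoincare4-10869, and the net new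
debt of this line is K_cpt + K_rig + the (known) endgame. -/
theorem rung_of_dominance
    (hdom : ∀ (M : Type) [TopologicalSpace M] [T2Space M] [SecondCountableTopology M]
      [ChartedSpace (EuclideanSpace ℝ (Fin 4)) M] [IsManifold (𝓡 4) ∞ M] [CompactSpace M] [T3Space M]
      [MeasurableSpace M] [BorelSpace M],
      M ≃ₕ Metric.sphere (0 : EuclideanSpace ℝ (Fin 5)) 1 →
      ∀ (g₀ : PseudoRiemannianMetric (𝓡 4) ∞ (EuclideanSpace ℝ (Fin 4)) (TangentSpace (𝓡 4) : M → Type _))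
        [g₀.HasLeviCivita] (hg₀ : g₀.IsRiemannian),
        (∀ x : M, 0 < g₀.scalarCurvature x) →
        ∀ c : ℝ, Real.log 2 + Real.log Real.pi / 2 - 3 / 2 < c →
        (∀ τ : ℝ, 0 < τ → ∀ φ : M → ℝ, ContMDiff (𝓡 4) 𝓘(ℝ, ℝ) ∞ φ →
          ∫ x, (4 * Real.pi * τ) ^ (-(4 : ℝ) / 2) * Real.exp (-φ x)
            ∂(riemannianMeasure (g₀.toContMDiffRiemannianMetric hg₀)) = 1 →
          c ≤ ∫ x, (τ * (g₀.scalarCurvature x + g₀.gradSq φ x) + φ x - 4) *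
            ((4 * Real.pi * τ) ^ (-(4 : ℝ) / 2) * Real.exp (-φ x))
            ∂(riemannianMeasure (g₀.toContMDiffRiemannianMetric hg₀))) →
        ∃ g : PseudoRiemannianMetric (𝓡 4) ∞ (EuclideanSpace ℝ (Fin 4)) (TangentSpace (𝓡 4) : M → Type _),
        ∃ _ : g.HasLeviCivita, ∃ (f : M → ℝ) (hg : g.IsRiemannian),
          ContMDiff (𝓡 4) 𝓘(ℝ, ℝ) ∞ f ∧
          (∀ (x : M) (X Y : TangentSpace (𝓡 4) x),
            g.ricci x X Y + g.hessian f x X Y = (1 / 2 : ℝ) * g.val x X Y) ∧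
          (∀ x : M, g.scalarCurvature x + g.gradSq f x = f x) ∧
          ENNReal.ofReal (16 * Real.pi ^ 2 * Real.exp c) ≤
            ∫⁻ x, ENNReal.ofReal (Real.exp (-f x)) ∂(riemannianMeasure (g.toContMDiffRiemannianMetric hg)))
    (hcpt : CompactShrinkerGap) : SubcylindricalRecognition := by
  intro M _ _ _ _ _ _ _ _ _ e g₀ _ hg₀ hR hν
  obtain ⟨δ, hδ, hfloor⟩ := hν
  have hc : Real.log 2 + Real.log Real.pi / 2 - 3 / 2 < Real.log 2 + Real.log Real.pi / 2 - 3 / 2 + δ := by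
    linarith
  obtain ⟨g, hLC, f, hg, hf, hsol, hnorm, hZ⟩ :=
    hdom M e g₀ hg₀ hR (Real.log 2 + Real.log Real.pi / 2 - 3 / 2 + δ) hc hfloor
  haveI : g.HasLeviCivita := hLC
  -- the dominating shrinker is dense: 16π² e^{ν_cyl + δ} > 16π² e^{ν_cyl} = 32π²√π e^{-3/2}
  have hthr : 32 * Real.pi ^ 2 * Real.sqrt Real.pi * Real.exp (-(3 : ℝ) / 2) <
      16 * Real.pi ^ 2 * Real.exp (Real.log 2 + Real.log Real.pi / 2 - 3 / 2 + δ) := by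
    have hπ : 0 < Real.pi := Real.pi_pos
    have hkey : Real.exp (Real.log 2 + Real.log Real.pi / 2 - 3 / 2) =
        2 * Real.sqrt Real.pi * Real.exp (-(3 : ℝ) / 2) := by
      rw [show Real.log 2 + Real.log Real.pi / 2 - 3 / 2 =
          Real.log 2 + Real.log Real.pi / 2 + (-(3 : ℝ) / 2) by ring, Real.exp_add, Real.exp_add,
        Real.exp_log (by norm_num : (0 : ℝ) < 2), Real.sqrt_eq_rpow, Real.rpow_def_of_pos hπ]
      ring_nf
    have hlt : Real.exp (Real.log 2 + Real.log Real.pi / 2 - 3 / 2) <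
        Real.exp (Real.log 2 + Real.log Real.pi / 2 - 3 / 2 + δ) := Real.exp_lt_exp.mpr (by linarith)
    have h16 : 0 < 16 * Real.pi ^ 2 := by positivity
    calc 32 * Real.pi ^ 2 * Real.sqrt Real.pi * Real.exp (-(3 : ℝ) / 2)
        = 16 * Real.pi ^ 2 * Real.exp (Real.log 2 + Real.log Real.pi / 2 - 3 / 2) := by
          rw [hkey]; ring
      _ < 16 * Real.pi ^ 2 * Real.exp (Real.log 2 + Real.log Real.pi / 2 - 3 / 2 + δ) :=
          mul_lt_mul_of_pos_left hlt h16
  have hdense : ENNReal.ofReal (32 * Real.pi ^ 2 * Real.sqrt Real.pi * Real.exp (-(3 : ℝ) / 2)) <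
      ∫⁻ x, ENNReal.ofReal (Real.exp (-f x)) ∂(riemannianMeasure (g.toContMDiffRiemannianMetric hg)) :=
    lt_of_lt_of_le ((ENNReal.ofReal_lt_ofReal_iff (by positivity)).mpr hthr) hZ
  exact hcpt M e g f hg hf hsol hnorm hdense

end Summit.SmoothPoincare4.SmoothPoincare4.Cruxes.CompactShrinkerGap.DecayClimbNumax
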